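import Summits.ABC.IUTFork.Cor312LicenceTameBoundary
import Summits.ABC.IUTFork.Cor312LicenceTameExactRealising
import Literature.IUT.LogVolume.UnitLogTorsionFreeBallCriterion
import HarnessLib

/-!
# [IUTchIII] Cor. 3.12, branch C — D-0079 R-W strata U1 ∪ U1½ DECIDED BY ONE PREDICATE: for REALISING pilot ideles over bad fibres with
# `p > 2`, `e_p ≤ p − 1` and NO non-trivial `p`-th root of unity in `K_x`, the per-datum licence (and the S_H antecedent) is
# `∀ bad w | p, ∀ j ≤ l⋆: e_p·((j²·P_w − 1) div e_p) + 1 − j·(e_p − 1) ≤ P_w` — the T1 tame predicate, unchanged at the boundary `e_p = p − 1`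

PROOF-ONLY record file (no `def`, no new `Prop`, no instance) of the abc-iut cell (branch D seat abc-iut-D1-prv, gen 4; D-0079 R-W
«WINDOW Θ-SIDE INEQUALITY», row «W:T1½ TAME-BOUNDARY lane=U», plan g9 RULING C-R29 (2): «extend the T1 iff (p448597/p449282) to
`e = p − 1` under `hμ : ζ_p ∉ K_w` via `logUnits_eq_closedBall_of_le_pred` — both legs»). TAKES NO SIDE on [IUTchIII] Cor. 3.12 or on any
author. Sequel of `Cor312LicenceTameBoundary.lean` (this seat: the dichotomy at BALL fibres) read through abc-iut-w6-d060's
`TorsionFree.logUnits_eq_closedBall_of_le_pred` (p442118: `p` odd, `e ≤ p − 1`, no `ζ ≠ 1` with `ζ^p = 1` ⇒ `log_p(𝒪_K^×) = 𝔪_K`) and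
abc-iut-w5-d009's realising-idele bookkeeping (`Cor312LicenceTameExactRealising`, p448597).

WHAT IS PROVED (namespace `Summit.ABC.IUTFork.Thm311.Real`). Hypothesis on every prime `p` UNDER `S` («torsion-free sub-wild fibre»): `p > 2`,
every place `x | p` has the SAME index `e(x|p) = e_p ≤ p − 1`, and `K_x` has no non-trivial `p`-th root of unity. This CONTAINS abc-iut-w5-d009's
uniformly tame hypothesis (`e_p ≤ p − 2` forces `ζ_p ∉ K_x`, since `ℚ_p(ζ_p)` has `e = p − 1`) and ADDS the boundary stratum U1½
(`e_p = p − 1`, `ζ_p ∉ K_x`) of plan g9 RULING C-R29 (1) / abc-iut-w5-d167's FINDING W-F1.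
* §1 `licence_settingDHVolSharp_iff_of_boundary_orders` / `licence_settingPrVolSharp_iff_of_boundary_orders` — integer-exponent form;
* §2 **`licence_settingDHVolSharp_iff_of_realises_boundary`**, **`licence_settingPrVolSharp_iff_of_realises_boundary`** — REALISING ideles with
  INTEGRAL q-degrees `P_q(w) = P_w ≥ 1` at the bad places: `Licence ↔ ∀ bad w | p, ∀ j = i+1: e_p·((j²·P_w − 1) div e_p) + 1 − j·(e_p − 1) ≤ P_w`;
* §3 **`exists_qPinned_and_hull_settingPrVolSharp_iff_of_realises_boundary`** — branch C's per-datum antecedent «∃ ρ qK, QPinned ∧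
  PilotKummerCompatHull» at `settingPrVolSharp` (any columns) ⟺ the same predicate.

READING (numbers, not adjectives; nothing about print): in OUR sharp containers with Dupuy–Hilado's typed (Ind2), the D-0079 R-W window's
stratum U1½ (`e_w = p − 1`, `ζ_p ∉ K_w`, ball-shaped unit-log shell) carries NO new arithmetic: the deciding predicate of U1 (T1, p448597)
decides it verbatim, on both legs; U1½ rows of the WINDOW-TABLE are routed by evaluating that ONE integer predicate. What made the stratum
look undecided was the [IUTchIV] Prop. 1.2 container (`a = 2/e`, `b = 1 − 1/e` at `e = p − 1`), not the lattice. HONEST SCOPE: OUR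
containers (Θ-regions constant in `m`); the hull-level licence is a STRONGER-THAN-PRINT form of Step (xi-f) (referee lanes A1/A2); nothing
about the printed GLOBAL inequality or the NUMBER-level corollary; refuted-as-typed ≠ refuted-in-print; nothing asserts or refutes
[IUTchIII] Cor. 3.12; typed ≠ proved; instantiated ≠ endorsed.
[cite: Mochizuki2012, IUTchIII Cor. 3.12 p. 173–175, Step (xi) (xi-f) p. 184, Thm. 3.11 (i) (Ind2) p. 154; IUTchIV Prop. 1.1 p. 9, Prop. 1.2 (i)(ii) p. 10]
[cite: DupuyHilado2025, §3.3, §3.4, §3.9, §4.9] [cite: NeukirchANT1999, Ch. II Prop. (5.5)–(5.7), (6.8)] [cite: Washington1997, §5.1]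
[claim: Mochizuki2012, status: disputed] for every IUT sentence quoted.
-/

noncomputable section

open Set Metric Function NumberField IsDedekindDomain
open scoped Pointwise

namespace Summit.ABC.IUTFork.Thm311.Real

open Cor312 Cor312.Setting Cor312Vol Cor312Vol.ExplicitDepth Literature.IUT.LogThetaLattice Literature.IUT.LogVolume
open Literature.NumberTheory.NumberFields Literature.NumberTheory.GaloisRepresentations.Ultrametric

variable {F : Type} [Field F] [NumberField F] (X : PilotData F) {logv : PadicLogs F} (hlog : LogvAnalytic logv)
  (M : Type) [Field M] [NumberField M]
  (archPk : ∀ (j : (thetaIndex X).Label) (vQ : (thetaIndex X).VQ), Set ((logShellsDH X logv).Packet j vQ))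
  (archSub : ∀ (j : (thetaIndex X).Label) (v : (thetaIndex X).V),
    Set ((logShellsDH X logv).Packet j ((thetaIndex X).over v)))
  (Ψ : ℤ → ∀ v : (thetaIndex X).V, v ∈ (thetaIndex X).Vbad → Set ((logShellsDH X logv).StarPacket v))
  (act : ℤ → ∀ v : (thetaIndex X).V, v ∈ (thetaIndex X).Vbad →
    (logShellsDH X logv).StarPacket v → Module.End ℚ ((logShellsDH X logv).StarPacket v))
  (Mmod : ℤ → ∀ j : (thetaIndex X).LabelStar, Set ((logShellsDH X logv).GlobalPacket j.1))
  (region : ℤ → ∀ j : (thetaIndex X).LabelStar, FinDivisor M → ∀ vQ : (thetaIndex X).VQ,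
    Set ((logShellsDH X logv).Packet j.1 vQ))
  (n : ℤ) {HT : Type} {LogLink : HT → HT → Type} {IsFull : ∀ {s t : HT}, LogLink s t → Prop}
  (lat : LGPGaussianLogThetaLattice LogLink IsFull)
  {Frd : Type} {IsoF : Frd → Frd → Type} {Ob : Frd → Type} {realify : Frd → Frd} {Strip : Type}
  {IsoS : Strip → Strip → Type} {Mv : ∀ v : (thetaIndex X).V, v ∈ (thetaIndex X).Vbad → Type}
  [∀ v h, Monoid (Mv v h)]
  (sig : GlobalLGPFrobenioidSignature (thetaIndex X).lstar (thetaIndex X).V (· ∈ (thetaIndex X).Vbad)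
    Frd IsoF Ob realify Strip IsoS Mv)
  (split : SplittingMonoids Mv) {ObΔ : Type} {N : ∀ v : (thetaIndex X).V, v ∈ (thetaIndex X).Vbad → Type}
  [∀ v h, Monoid (N v h)] (qData : QPilotData ObΔ N)
  (tq : ∀ (pp : Nat.Primes) (x : (thetaIndex X).Fibre (.inr pp)), haveI : Fact (pp : ℕ).Prime := ⟨pp.2⟩; kOf X pp.1 x)
  (t : ∀ (pp : Nat.Primes) (_ : Fin X.lstar) (x : (thetaIndex X).Fibre (.inr pp)),
    haveI : Fact (pp : ℕ).Prime := ⟨pp.2⟩; kOf X pp.1 x)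
  (htq0 : ∀ pp x, tq pp x ≠ 0)
  (htq1 : ∀ (pp : Nat.Primes) (x : (thetaIndex X).Fibre (.inr pp)),
    haveI : Fact (pp : ℕ).Prime := ⟨pp.2⟩; placeOf X pp.1 x ∉ X.S → ‖tq pp x‖ = 1)
  (col : ℤ → Column (logShellsDH X logv))
  (ht0 : ∀ pp i x, t pp i x ≠ 0)
  (ht : ∀ (pp : Nat.Primes) (i : Fin X.lstar) (x : (thetaIndex X).Fibre (.inr pp)),
    haveI : Fact (pp : ℕ).Prime := ⟨pp.2⟩
    Real.log ‖t pp i x‖ = -(X.thetaPilot i (placeOf X pp.1 x)) * logNorm F (placeOf X pp.1 x) /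
      localDegree F (placeOf X pp.1 x))
  (htq : ∀ (pp : Nat.Primes) (x : (thetaIndex X).Fibre (.inr pp)),
    haveI : Fact (pp : ℕ).Prime := ⟨pp.2⟩
    Real.log ‖tq pp x‖ = -(X.qPilot (placeOf X pp.1 x)) * logNorm F (placeOf X pp.1 x) /
      localDegree F (placeOf X pp.1 x))

/-! ## §1. Integer-exponent form at torsion-free sub-wild fibres (`p > 2`, `e_p ≤ p − 1`, no `ζ_p` in `K_x`) -/

/-- **THE (xi-f) LICENCE AT `settingDHVolSharp` IS DECIDED AT TORSION-FREE SUB-WILD BAD FIBRES** (strata U1 ∪ U1½). Θ-ideles units off `S`;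
at every prime `p` UNDER `S`: `p > 2`, one index `e_p ≤ p − 1` with `e(x|p) = e_p`, a uniformizer `ϖ_x`, and NO `ζ ≠ 1` with `ζ^p = 1` in `K_x`,
at every `x | p`; at every BAD `w | p` and label `j = i+1` integer exponents `‖t_{Θ,j,w}‖ = ‖ϖ_w‖^{m_Θ(j,w)}`, `‖t_{q,w}‖ = ‖ϖ_w‖^{m_q(w)}`, `m_Θ(j,w) ≥ 1`.
THEN `Thm311ToCor312.Licence ↔ ∀ bad w | p, ∀ j: e_p·((m_Θ(j,w) − 1) div e_p) + 1 − j·(e_p − 1) ≤ m_q(w)` — abc-iut-w4-d006's all-tame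
predicate (p445547), since the unit-log shell is the ball `𝔪_x` throughout (`TorsionFree.logUnits_eq_closedBall_of_le_pred`).
[cite: Mochizuki2012, IUTchIV Prop. 1.1 p. 9, Prop. 1.2 (i)(ii) p. 10] [cite: NeukirchANT1999, Ch. II Prop. (5.5)–(5.7)]
[cite: DupuyHilado2025, §3.9, §4.9] [claim: Mochizuki2012, status: disputed] -/
theorem licence_settingDHVolSharp_iff_of_boundary_orders
    (ht1 : ∀ (pp : Nat.Primes) (i : Fin X.lstar) (x : (thetaIndex X).Fibre (.inr pp)),
      haveI : Fact (pp : ℕ).Prime := ⟨pp.2⟩; placeOf X pp.1 x ∉ X.S → ‖t pp i x‖ = 1)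
    (e : Nat.Primes → ℕ)
    (ϖ : ∀ (pp : Nat.Primes) (x : (thetaIndex X).Fibre (.inr pp)), haveI : Fact (pp : ℕ).Prime := ⟨pp.2⟩; (kOf X pp.1 x)ˣ)
    (hfib : ∀ (pp : Nat.Primes) (x : (thetaIndex X).Fibre (.inr pp)),
      haveI : Fact (pp : ℕ).Prime := ⟨pp.2⟩
      (∃ w : (thetaIndex X).Fibre (.inr pp), placeOf X pp.1 w ∈ X.S) →
        2 < (pp : ℕ) ∧ e pp ≤ (pp : ℕ) - 1 ∧ (placeOf X pp.1 x).asIdeal.ramificationIdx ℤ = e pp ∧ IsUniformizer (ϖ pp x) ∧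
          ∀ ζ : kOf X pp.1 x, ζ ^ (pp : ℕ) = 1 → ζ = 1)
    (mΘ : ∀ pp : Nat.Primes, Fin (thetaIndex X).lstar → (thetaIndex X).Fibre (.inr pp) → ℤ)
    (mq : ∀ pp : Nat.Primes, (thetaIndex X).Fibre (.inr pp) → ℤ)
    (hΘ : ∀ (pp : Nat.Primes) (i : Fin (thetaIndex X).lstar) (w : (thetaIndex X).Fibre (.inr pp)),
      haveI : Fact (pp : ℕ).Prime := ⟨pp.2⟩
      placeOf X pp.1 w ∈ X.S → ‖t pp i w‖ = ‖(ϖ pp w : kOf X pp.1 w)‖ ^ mΘ pp i w)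
    (hq : ∀ (pp : Nat.Primes) (w : (thetaIndex X).Fibre (.inr pp)),
      haveI : Fact (pp : ℕ).Prime := ⟨pp.2⟩
      placeOf X pp.1 w ∈ X.S → ‖tq pp w‖ = ‖(ϖ pp w : kOf X pp.1 w)‖ ^ mq pp w)
    (h1 : ∀ (pp : Nat.Primes) (i : Fin (thetaIndex X).lstar) (w : (thetaIndex X).Fibre (.inr pp)),
      haveI : Fact (pp : ℕ).Prime := ⟨pp.2⟩; placeOf X pp.1 w ∈ X.S → 1 ≤ mΘ pp i w) :
    Thm311ToCor312.Licence (settingDHVolSharp X hlog M archPk archSub Ψ act Mmod region n lat sig split qData tq t htq0 htq1) ↔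
      ∀ (pp : Nat.Primes) (i : Fin (thetaIndex X).lstar) (w : (thetaIndex X).Fibre (.inr pp)),
        haveI : Fact (pp : ℕ).Prime := ⟨pp.2⟩; placeOf X pp.1 w ∈ X.S →
          (e pp : ℤ) * ((mΘ pp i w - 1) / e pp) + 1 - ((i : ℕ) + 1 : ℕ) * ((e pp : ℤ) - 1) ≤ mq pp w := by
  refine licence_settingDHVolSharp_iff_of_ball_orders X hlog M archPk archSub Ψ act Mmod region n lat sig split qData tq t htq0 htq1
    ht1 e ϖ (fun pp x hS => ?_) mΘ mq hΘ hq h1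
  haveI : Fact (pp : ℕ).Prime := ⟨pp.2⟩
  obtain ⟨hp2, hep, hram, hϖ, hμ⟩ := hfib pp x hS
  have heK : absRamificationIdx (pp : ℕ) (kOf X pp.1 x) ≤ (pp : ℕ) - 1 :=
    ((absRamificationIdx_rescaledCompletion F (pp : ℕ) (placeOf X pp.1 x) (natCast_mem_placeOf X pp.1 x)).trans hram).le.trans hep
  exact ⟨hp2, hram, hϖ, TorsionFree.logUnits_eq_closedBall_of_le_pred (pp : ℕ) hϖ hμ (by omega) heK⟩

/-- **The same at the PRINT-NORMALISED setting `settingPrVolSharp`** (`licence_settingPrVolSharp_iff_settingDHVolSharp`).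
[claim: Mochizuki2012, status: disputed] -/
theorem licence_settingPrVolSharp_iff_of_boundary_orders
    (ht1 : ∀ (pp : Nat.Primes) (i : Fin X.lstar) (x : (thetaIndex X).Fibre (.inr pp)),
      haveI : Fact (pp : ℕ).Prime := ⟨pp.2⟩; placeOf X pp.1 x ∉ X.S → ‖t pp i x‖ = 1)
    (e : Nat.Primes → ℕ)
    (ϖ : ∀ (pp : Nat.Primes) (x : (thetaIndex X).Fibre (.inr pp)), haveI : Fact (pp : ℕ).Prime := ⟨pp.2⟩; (kOf X pp.1 x)ˣ)
    (hfib : ∀ (pp : Nat.Primes) (x : (thetaIndex X).Fibre (.inr pp)),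
      haveI : Fact (pp : ℕ).Prime := ⟨pp.2⟩
      (∃ w : (thetaIndex X).Fibre (.inr pp), placeOf X pp.1 w ∈ X.S) →
        2 < (pp : ℕ) ∧ e pp ≤ (pp : ℕ) - 1 ∧ (placeOf X pp.1 x).asIdeal.ramificationIdx ℤ = e pp ∧ IsUniformizer (ϖ pp x) ∧
          ∀ ζ : kOf X pp.1 x, ζ ^ (pp : ℕ) = 1 → ζ = 1)
    (mΘ : ∀ pp : Nat.Primes, Fin (thetaIndex X).lstar → (thetaIndex X).Fibre (.inr pp) → ℤ)
    (mq : ∀ pp : Nat.Primes, (thetaIndex X).Fibre (.inr pp) → ℤ)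
    (hΘ : ∀ (pp : Nat.Primes) (i : Fin (thetaIndex X).lstar) (w : (thetaIndex X).Fibre (.inr pp)),
      haveI : Fact (pp : ℕ).Prime := ⟨pp.2⟩
      placeOf X pp.1 w ∈ X.S → ‖t pp i w‖ = ‖(ϖ pp w : kOf X pp.1 w)‖ ^ mΘ pp i w)
    (hq : ∀ (pp : Nat.Primes) (w : (thetaIndex X).Fibre (.inr pp)),
      haveI : Fact (pp : ℕ).Prime := ⟨pp.2⟩
      placeOf X pp.1 w ∈ X.S → ‖tq pp w‖ = ‖(ϖ pp w : kOf X pp.1 w)‖ ^ mq pp w)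
    (h1 : ∀ (pp : Nat.Primes) (i : Fin (thetaIndex X).lstar) (w : (thetaIndex X).Fibre (.inr pp)),
      haveI : Fact (pp : ℕ).Prime := ⟨pp.2⟩; placeOf X pp.1 w ∈ X.S → 1 ≤ mΘ pp i w) :
    Thm311ToCor312.Licence (settingPrVolSharp X hlog M archPk archSub Ψ act Mmod region n lat sig split qData tq t htq0 htq1) ↔
      ∀ (pp : Nat.Primes) (i : Fin (thetaIndex X).lstar) (w : (thetaIndex X).Fibre (.inr pp)),
        haveI : Fact (pp : ℕ).Prime := ⟨pp.2⟩; placeOf X pp.1 w ∈ X.S →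
          (e pp : ℤ) * ((mΘ pp i w - 1) / e pp) + 1 - ((i : ℕ) + 1 : ℕ) * ((e pp : ℤ) - 1) ≤ mq pp w := by
  rw [licence_settingPrVolSharp_iff_settingDHVolSharp]
  exact licence_settingDHVolSharp_iff_of_boundary_orders X hlog M archPk archSub Ψ act Mmod region n lat sig split qData tq t htq0 htq1
    ht1 e ϖ hfib mΘ mq hΘ hq h1

/-! ## §2. REALISING ideles with INTEGRAL q-degrees: the licence is the T1 predicate on U1 ∪ U1½ -/

include ht0 ht htq in
/-- **THE (xi-f) LICENCE AT `settingDHVolSharp` FOR REALISING IDELES WITH INTEGRAL q-DEGREES OVER TORSION-FREE SUB-WILD BAD FIBRES IS THE T1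
PREDICATE.** Θ- and q-ideles realising the pilot divisors of `X`; at every BAD place `w` the q-degree is an integer `P_q(w) = P_w ∈ ℤ_{≥1}`;
every place `x` of `F` over a prime `p` below a bad place has `p > 2`, the SAME index `e(x|p) = e_p ≤ p − 1`, and `K_x` has no non-trivial
`p`-th root of unity. THEN abc-iut-c312-1's `Thm311ToCor312.Licence` at abc-iut-c312-3's `settingDHVolSharp X …` holds **iff** at every bad
`w | p` and every label `j = i+1 ∈ 𝔽_l^⋇`: `e_p·((j²·P_w − 1) div e_p) + 1 − j·(e_p − 1) ≤ P_w`. abc-iut-w5-d009's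
`licence_settingDHVolSharp_iff_of_realises_tame` (p448597) is the sub-case `e_p ≤ p − 2`; the boundary `e_p = p − 1` (stratum U1½) is new.
(`m_Θ = j²·P_w`, `m_q = P_w` read off `norm_thetaIdele_eq_rpow_of_realises` / `norm_qIdele_eq_rpow_of_realises`, uniformizers from
`exists_isUniformizer_rescaledCompletion`.) [cite: DupuyHilado2025, §3.3, §3.4, §4.9] [cite: NeukirchANT1999, Ch. II Prop. (5.5)–(5.7), (6.8)]
[claim: Mochizuki2012, status: disputed] -/
theorem licence_settingDHVolSharp_iff_of_realises_boundary (e : Nat.Primes → ℕ)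
    (hfib : ∀ (pp : Nat.Primes) (x : (thetaIndex X).Fibre (.inr pp)),
      haveI : Fact (pp : ℕ).Prime := ⟨pp.2⟩
      (∃ w : (thetaIndex X).Fibre (.inr pp), placeOf X pp.1 w ∈ X.S) →
        2 < (pp : ℕ) ∧ e pp ≤ (pp : ℕ) - 1 ∧ (placeOf X pp.1 x).asIdeal.ramificationIdx ℤ = e pp ∧
          ∀ ζ : kOf X pp.1 x, ζ ^ (pp : ℕ) = 1 → ζ = 1)
    (P : ∀ pp : Nat.Primes, (thetaIndex X).Fibre (.inr pp) → ℕ)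
    (hP : ∀ (pp : Nat.Primes) (w : (thetaIndex X).Fibre (.inr pp)),
      haveI : Fact (pp : ℕ).Prime := ⟨pp.2⟩; placeOf X pp.1 w ∈ X.S → X.qPilot (placeOf X pp.1 w) = P pp w)
    (hP1 : ∀ (pp : Nat.Primes) (w : (thetaIndex X).Fibre (.inr pp)),
      haveI : Fact (pp : ℕ).Prime := ⟨pp.2⟩; placeOf X pp.1 w ∈ X.S → 1 ≤ P pp w) :
    Thm311ToCor312.Licence (settingDHVolSharp X hlog M archPk archSub Ψ act Mmod region n lat sig split qData tq t htq0 htq1) ↔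
      ∀ (pp : Nat.Primes) (i : Fin (thetaIndex X).lstar) (w : (thetaIndex X).Fibre (.inr pp)),
        haveI : Fact (pp : ℕ).Prime := ⟨pp.2⟩; placeOf X pp.1 w ∈ X.S →
          (e pp : ℤ) * (((((i : ℕ) + 1 : ℕ) : ℤ) ^ 2 * (P pp w : ℤ) - 1) / e pp) + 1 -
            ((i : ℕ) + 1 : ℕ) * ((e pp : ℤ) - 1) ≤ (P pp w : ℤ) := by
  -- uniformizers of the rescaled completions, `‖ϖ_x‖ = p^{−1/e(x|p)}`
  have hex : ∀ (pp : Nat.Primes) (x : (thetaIndex X).Fibre (.inr pp)),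
      haveI : Fact (pp : ℕ).Prime := ⟨pp.2⟩
      ∃ ϖ : (kOf X pp.1 x)ˣ, IsUniformizer ϖ ∧ ‖(ϖ : kOf X pp.1 x)‖ =
        ((pp : ℕ) : ℝ) ^ (-(1 / ((placeOf X pp.1 x).asIdeal.ramificationIdx ℤ : ℝ))) := fun pp x => by
    haveI : Fact (pp : ℕ).Prime := ⟨pp.2⟩
    exact exists_isUniformizer_rescaledCompletion F pp.1 (placeOf X pp.1 x) (natCast_mem_placeOf X pp.1 x)
  choose ϖ hϖ using hex
  -- the norm identities at a bad place `w | p`: `‖t_{Θ,i,w}‖ = ‖ϖ_w‖^{(i+1)²P_w}`, `‖t_{q,w}‖ = ‖ϖ_w‖^{P_w}`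
  have key : ∀ (pp : Nat.Primes) (w : (thetaIndex X).Fibre (.inr pp)),
      haveI : Fact (pp : ℕ).Prime := ⟨pp.2⟩
      placeOf X pp.1 w ∈ X.S → ∀ m : ℤ, ∀ c : ℝ, (c : ℝ) = (m : ℝ) →
        ((pp : ℕ) : ℝ) ^ (-(c * X.qPilot (placeOf X pp.1 w)) / (ramIdx F (placeOf X pp.1 w) : ℝ)) =
          ‖(ϖ pp w : kOf X pp.1 w)‖ ^ (m * (P pp w : ℤ)) := by
    intro pp w hw m c hc
    haveI : Fact (pp : ℕ).Prime := ⟨pp.2⟩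
    obtain ⟨-, -, hram, -⟩ := hfib pp w ⟨w, hw⟩
    have hp0 : (0 : ℝ) < ((pp : ℕ) : ℝ) := by exact_mod_cast pp.2.pos
    have hramF : (ramIdx F (placeOf X pp.1 w) : ℝ) = (e pp : ℝ) := by
      rw [ramIdx_eq F (placeOf X pp.1 w), hram]
    have hϖn : ‖(ϖ pp w : kOf X pp.1 w)‖ = ((pp : ℕ) : ℝ) ^ (-(1 / (e pp : ℝ))) := by
      rw [(hϖ pp w).2, hram]
    rw [hϖn, ← Real.rpow_intCast, ← Real.rpow_mul hp0.le, hP pp w hw, hramF, hc]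
    congr 1
    push_cast
    ring
  refine licence_settingDHVolSharp_iff_of_boundary_orders X hlog M archPk archSub Ψ act Mmod region n lat sig split qData tq t htq0
    htq1 (fun pp i x hx => norm_eq_one_of_realises X t ht0 ht pp i x hx) e ϖ (fun pp x hS => ?_)
    (fun pp i w => ((((i : ℕ) + 1 : ℕ) : ℤ) ^ 2 * (P pp w : ℤ))) (fun pp w => (P pp w : ℤ))
    (fun pp i w hw => ?_) (fun pp w hw => ?_) (fun pp i w hw => ?_)
  · -- the torsion-free sub-wild fibre with its uniformizers
    haveI : Fact (pp : ℕ).Prime := ⟨pp.2⟩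
    obtain ⟨hp2, hep, hram, hμ⟩ := hfib pp x hS
    exact ⟨hp2, hep, hram, (hϖ pp x).1, hμ⟩
  · -- `‖t_{Θ,i,w}‖ = ‖ϖ_w‖^{(i+1)²·P_w}`
    haveI : Fact (pp : ℕ).Prime := ⟨pp.2⟩
    rw [norm_thetaIdele_eq_rpow_of_realises X tq t htq0 ht0 ht htq pp i w]
    exact key pp w hw _ _ (by push_cast; ring)
  · -- `‖t_{q,w}‖ = ‖ϖ_w‖^{P_w}`
    haveI : Fact (pp : ℕ).Prime := ⟨pp.2⟩
    rw [norm_qIdele_eq_rpow_of_realises X tq htq0 htq pp w]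
    have h := key pp w hw 1 1 (by norm_num)
    rw [one_mul, one_mul] at h
    exact h
  · -- `1 ≤ (i+1)²·P_w`
    haveI : Fact (pp : ℕ).Prime := ⟨pp.2⟩
    have h1 : (1 : ℤ) ≤ (P pp w : ℤ) := by exact_mod_cast hP1 pp w hw
    have h2 : (1 : ℤ) ≤ (((i : ℕ) + 1 : ℕ) : ℤ) ^ 2 := one_le_pow₀ (by exact_mod_cast Nat.succ_le_succ (Nat.zero_le _))
    nlinarith

include ht0 ht htq in
/-- **The same at the print-normalised setting `settingPrVolSharp`** (abc-iut-c312-7; `licence_settingPrVolSharp_iff_settingDHVolSharp`): the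
DECIDING DECL OF RECORD for the D-0079 R-W strata U1 ∪ U1½ at realising ideles with integral q-degrees.
[cite: DupuyHilado2025, §3.4, §4.9] [claim: Mochizuki2012, status: disputed] -/
theorem licence_settingPrVolSharp_iff_of_realises_boundary (e : Nat.Primes → ℕ)
    (hfib : ∀ (pp : Nat.Primes) (x : (thetaIndex X).Fibre (.inr pp)),
      haveI : Fact (pp : ℕ).Prime := ⟨pp.2⟩
      (∃ w : (thetaIndex X).Fibre (.inr pp), placeOf X pp.1 w ∈ X.S) →
        2 < (pp : ℕ) ∧ e pp ≤ (pp : ℕ) - 1 ∧ (placeOf X pp.1 x).asIdeal.ramificationIdx ℤ = e pp ∧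
          ∀ ζ : kOf X pp.1 x, ζ ^ (pp : ℕ) = 1 → ζ = 1)
    (P : ∀ pp : Nat.Primes, (thetaIndex X).Fibre (.inr pp) → ℕ)
    (hP : ∀ (pp : Nat.Primes) (w : (thetaIndex X).Fibre (.inr pp)),
      haveI : Fact (pp : ℕ).Prime := ⟨pp.2⟩; placeOf X pp.1 w ∈ X.S → X.qPilot (placeOf X pp.1 w) = P pp w)
    (hP1 : ∀ (pp : Nat.Primes) (w : (thetaIndex X).Fibre (.inr pp)),
      haveI : Fact (pp : ℕ).Prime := ⟨pp.2⟩; placeOf X pp.1 w ∈ X.S → 1 ≤ P pp w) :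
    Thm311ToCor312.Licence (settingPrVolSharp X hlog M archPk archSub Ψ act Mmod region n lat sig split qData tq t htq0 htq1) ↔
      ∀ (pp : Nat.Primes) (i : Fin (thetaIndex X).lstar) (w : (thetaIndex X).Fibre (.inr pp)),
        haveI : Fact (pp : ℕ).Prime := ⟨pp.2⟩; placeOf X pp.1 w ∈ X.S →
          (e pp : ℤ) * (((((i : ℕ) + 1 : ℕ) : ℤ) ^ 2 * (P pp w : ℤ) - 1) / e pp) + 1 -
            ((i : ℕ) + 1 : ℕ) * ((e pp : ℤ) - 1) ≤ (P pp w : ℤ) := by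
  rw [licence_settingPrVolSharp_iff_settingDHVolSharp]
  exact licence_settingDHVolSharp_iff_of_realises_boundary X hlog M archPk archSub Ψ act Mmod region n lat sig split qData tq t htq0 htq1
    ht0 ht htq e hfib P hP hP1

/-! ## §3. Branch C's S_H antecedent at realising ideles over torsion-free sub-wild fibres -/

include ht0 ht htq in
/-- **BRANCH C's PER-DATUM ANTECEDENT «∃ ρ qK, QPinned ∧ PilotKummerCompatHull» AT `settingPrVolSharp` FOR REALISING IDELES WITH INTEGRAL
q-DEGREES OVER TORSION-FREE SUB-WILD BAD FIBRES IS THE T1 PREDICATE** (any columns `col`; realising q-ideles have norm `≤ 1`,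
`norm_qIdele_le_one_of_realises`; abc-iut-w5-d009's `exists_qPinned_and_hull_settingPrVolSharp_iff_licence`). Same hypotheses as
`licence_settingPrVolSharp_iff_of_realises_boundary`: this is the `hSHw` binder of branch C's certificates of record
(`Conditional.abc_of_SH_v10K_window` p447945 / `…_szpiroBad` p449402) decided datum by datum on the strata U1 ∪ U1½.
[cite: DupuyHilado2025, §3.3, §3.4, §4.9] [cite: NeukirchANT1999, Ch. II Prop. (5.5)–(5.7)] [claim: Mochizuki2012, status: disputed] -/
theorem exists_qPinned_and_hull_settingPrVolSharp_iff_of_realises_boundary (e : Nat.Primes → ℕ)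
    (hfib : ∀ (pp : Nat.Primes) (x : (thetaIndex X).Fibre (.inr pp)),
      haveI : Fact (pp : ℕ).Prime := ⟨pp.2⟩
      (∃ w : (thetaIndex X).Fibre (.inr pp), placeOf X pp.1 w ∈ X.S) →
        2 < (pp : ℕ) ∧ e pp ≤ (pp : ℕ) - 1 ∧ (placeOf X pp.1 x).asIdeal.ramificationIdx ℤ = e pp ∧
          ∀ ζ : kOf X pp.1 x, ζ ^ (pp : ℕ) = 1 → ζ = 1)
    (P : ∀ pp : Nat.Primes, (thetaIndex X).Fibre (.inr pp) → ℕ)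
    (hP : ∀ (pp : Nat.Primes) (w : (thetaIndex X).Fibre (.inr pp)),
      haveI : Fact (pp : ℕ).Prime := ⟨pp.2⟩; placeOf X pp.1 w ∈ X.S → X.qPilot (placeOf X pp.1 w) = P pp w)
    (hP1 : ∀ (pp : Nat.Primes) (w : (thetaIndex X).Fibre (.inr pp)),
      haveI : Fact (pp : ℕ).Prime := ⟨pp.2⟩; placeOf X pp.1 w ∈ X.S → 1 ≤ P pp w) :
    (∃ (ρ : (∀ v : (thetaIndex X).V, v ∈ (thetaIndex X).Vbad → Set ((logShellsDH X logv).StarPacket v)) →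
          ∀ (j : (thetaIndex X).Label) (vQ : (thetaIndex X).VQ), Set ((logShellsDH X logv).Packet j vQ))
        (qK : ∀ v : (thetaIndex X).V, v ∈ (thetaIndex X).Vbad → Set ((logShellsDH X logv).StarPacket v)),
        QPinned ({ toSituation := situationPrVol X hlog M archPk archSub Ψ act Mmod region, col := col } :
            LatticeSituation (thetaIndex X))
          (settingPrVolSharp X hlog M archPk archSub Ψ act Mmod region n lat sig split qData tq t htq0 htq1) ρ qK ∧
        PilotKummerCompatHull ({ toSituation := situationPrVol X hlog M archPk archSub Ψ act Mmod region, col := col } :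
            LatticeSituation (thetaIndex X))
          (settingPrVolSharp X hlog M archPk archSub Ψ act Mmod region n lat sig split qData tq t htq0 htq1) ρ qK) ↔
      ∀ (pp : Nat.Primes) (i : Fin (thetaIndex X).lstar) (w : (thetaIndex X).Fibre (.inr pp)),
        haveI : Fact (pp : ℕ).Prime := ⟨pp.2⟩; placeOf X pp.1 w ∈ X.S →
          (e pp : ℤ) * (((((i : ℕ) + 1 : ℕ) : ℤ) ^ 2 * (P pp w : ℤ) - 1) / e pp) + 1 -
            ((i : ℕ) + 1 : ℕ) * ((e pp : ℤ) - 1) ≤ (P pp w : ℤ) := by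
  rw [exists_qPinned_and_hull_settingPrVolSharp_iff_licence X hlog M archPk archSub Ψ act Mmod region n lat sig split qData tq t htq0
    htq1 col (fun pp x => norm_qIdele_le_one_of_realises X tq htq0 htq pp x)]
  exact licence_settingPrVolSharp_iff_of_realises_boundary X hlog M archPk archSub Ψ act Mmod region n lat sig split qData tq t htq0 htq1
    ht0 ht htq e hfib P hP hP1

end Summit.ABC.IUTFork.Thm311.Real

end
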